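import Summits.CriticalPhenomena.PercolationContinuityZ3.Theorems.PercNearOneGluingNoHeavyQuantConvWindowHolds
import Summits.CriticalPhenomena.PercolationContinuityZ3.Theorems.PercNearOneGluingNoHeavyQuantGatedConvSplit
import HarnessLib

/-!
# QUANT lane R8, T-DEC: the convolution closure from ONE datum of the decomposed factor MODULO its light straddlers —
# `lconv μ₁ μ₂ ∈ D(T₁+T₂, j′)` whenever `μ₁` is window-DEC and `μ₂` has a datum at `(T₂, j′)` each of whose LIGHT STRADDLING credit pairs
# `{lo, hi; γ}` slices `μ₁` into a DEC law; and the "higher-target" discharge of a light straddler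

builds on p205010 (kernel theorem, internal audit signed; external expert review pending)

Support file (`--supports stmt-CriticalPhenomena-4575`), QUANT lane seat prim-quant-census-1 (gen 21), rung R8 of
`run/shared/lean/prim/quant/LADDER.md`.  Memo `run/shared/lean/prim/quant/prim-quant-census-1/CONV-RESIDUE-G21.md`.  One `Prop` definition
(`LawDec.PDECAtT`, a datum whose light straddlers satisfy a given predicate), theorems with standard axioms, no sorries.  Continues census-1 g20's
`…QuantConvWindow` / `…QuantConvWindowHolds` (the one-sided theorem `lconv_decAtT_of_window_bdecAtT'`: the decomposed factor has a datum WITHOUT light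
straddlers) and serves census-2 g56's `LawDec.ConvClosedTResidue` (`…QuantConvAtoms`: both factors small, neither with such a datum).

WHY (memo §2–§4, exact censuses of this seat).  For the residue pairs (2-low atom ⊗ 2-low atom) of `ConvClosedT` the exact census says: decompose ONE
factor `μ₂` by its datum at the TOP layer `j′` (an expensive heavy credit pair, a LIGHT STRADDLING credit pair `{lo, hi; γ}` — `γ < x`,
`hi ≤ j′ < hi + M₁` — and points); every piece of `lconv μ₁ μ₂` is then DEC on its own — heavy pieces by the slice theorem, points by the double
shift bonus, and the light straddling piece `(1−γ)·shift_lo μ₁ + γ·shift_hi μ₁` in 417 + 3 / 420 residue pairs for at least one choice of the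
decomposed factor (memo §3: "top datum suffices"; by contrast no fixed pair of layers of `μ₁` suffices in general, and the dual single-layer
principle of the slice programme FAILS for atomic second factors — memo §1).  This file is the kernel form of that architecture: the one-sided
theorem with the light straddlers handed to a predicate, so that the residue reduces to ONE law-level statement about light slices of 2-low atoms
at a straddling layer ("LS", memo §4), exactly as `SliceClosedWindowT` reduced to `SliceLawSW`.

* `LawDec.PDECAtT x T j′ M a P μ` — `μ` on `{0..M}` is an exact finite mixture of two-point components each of which is either valid WITHOUT a light
  straddler relative to `a` (`BValidAt`, typer g22/g23) or a light straddling credit pair `{lo, hi; g}` (`lo < hi ≤ j′ < hi + a`, `2lo < T`,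
  `x² < g < x`, credit `≥ T`) satisfying `P lo hi g`.
* `LawDec.BDECAtT.pdecAtT` (no light straddler ⟹ any `P`), `LawDec.pdecAtT_mono`, **`LawDec.pdecAtT_of_decAtT`** (a plain `DECAtT` datum all of
  whose potential light straddlers satisfy `P`).
* **`LawDec.lconv_decAtT_of_window_pdecAtT`** — `μ₁` DEC(T₁,·) on the window `[j′ − M₂, j′]`, `μ₂` with a `PDECAtT` datum at `(T₂, j′)` relative to
  `M₁` for the predicate "`(1−g)·shift_lo μ₁ + g·shift_hi μ₁ ∈ D(T₁+T₂, j′)`" ⟹ `lconv M₁ M₂ μ₁ μ₂ ∈ D(T₁+T₂, j′)`; mirror form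
  `lconv_decAtT_of_pdecAtT_window`.  With `BDECAtT.pdecAtT` it specialises to the one-sided theorem `lconv_decAtT_of_window_bdecAtT'`
  (`…QuantConvWindowHolds`; not restated here).
* **`LawDec.shift_lightPair_decAtT_of_higherTarget`** — the light straddling piece is DEC whenever `μ₁ ∈ D(T₁ + T₂ − 2lo, j′ − lo)` (the `lo`-copy
  read at the raised target) and `μ₁ ∈ D(T₁, j′ − hi)` (`T₂ ≤ 2hi`): the "trivial side" of the residue census (memo §3: 142 / 387 residue pairs),
  e.g. when `lo + top(μ₁) > j′` and `μ₁` is a single-absorber atom (giant mode at every target).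

HONEST: `ConvClosedTResidue`, `ConvClosedTSmall`, `ConvClosedT`, `WindowAtomDecomposition`, `SDECConvClosed`, `TreeBuiltDEC`, `TreeDEC`, `FarTreeRow`
remain OPEN; this file proves reductions and one discharge, not the light-slice statement LS itself.  RATE class log\* / honest sentence unchanged.

[this work]; memos CONV-G20, CONV-RESIDUE-G21 (census-1), CONV-ATOMS-G56 (census-2) (this lane).  Nothing here is cited as a published result.
The gluing rows served [cite: KozmaNitzan2024, Conjecture 3 (p. 15)]; product measure [cite: Grimmett1999, §1.3 p. 10].
-/

noncomputable section

namespace Summit.CriticalPhenomena.PercolationContinuityZ3.Theorems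

namespace Quant

open Finset

/-- the two-point law `{lo, hi; g}` (as in `…QuantLawDEC`) -/
local notation3 "TP[" lo ", " hi ", " g ", " h "]" =>
  (g : ℝ) * (if (h : ℕ) = (hi : ℕ) then (1 : ℝ) else 0) + (1 - (g : ℝ)) * (if (h : ℕ) = (lo : ℕ) then (1 : ℝ) else 0)

/-- the law `μ` shifted up by `s` (as in `…QuantConvHeavy`) -/
local notation3 "SH[" μ ", " s ", " h "]" => (if (s : ℕ) ≤ (h : ℕ) then (μ : ℕ → ℝ) ((h : ℕ) - (s : ℕ)) else (0 : ℝ))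

namespace LawDec

/-! ### Data whose light straddlers satisfy a predicate -/

/-- **DEC(j′) at target `T` by a datum whose LIGHT STRADDLERS (relative to `a`) satisfy `P`**: an exact finite mixture of two-point components,
each either valid without a light straddler (`BValidAt x T j′ a`) or a light straddling credit pair `{lo, hi; g}` — `lo < hi ≤ j′`, `j′ + 1 ≤ hi + a`,
`2lo < T`, `x² < g < x`, `T ≤ 2lo + (hi − lo)(g − x²)/(1 − x)` — with `P lo hi g`. [this work] -/
def PDECAtT (x T : ℝ) (j' M a : ℕ) (P : ℕ → ℕ → ℝ → Prop) (μ : ℕ → ℝ) : Prop :=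
  ∃ (ρ : Type) (_ : Fintype ρ) (lam g : ρ → ℝ) (lo hi : ρ → ℕ),
    (∀ r, 0 ≤ lam r) ∧ (∑ r, lam r = 1) ∧ (∀ r, 0 ≤ g r ∧ g r ≤ 1) ∧ (∀ r, lo r ≤ hi r) ∧ (∀ r, hi r ≤ M) ∧
    (∀ h, μ h = ∑ r, lam r * TP[lo r, hi r, g r, h]) ∧
    (∀ r, 0 < lam r → BValidAt x T j' a (lo r) (hi r) (g r) ∨
      (lo r < hi r ∧ hi r ≤ j' ∧ j' + 1 ≤ hi r + a ∧ 2 * (lo r : ℝ) < T ∧ x ^ 2 < g r ∧ g r < x ∧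
        T ≤ 2 * (lo r : ℝ) + ((hi r : ℝ) - lo r) * ((g r - x ^ 2) / (1 - x)) ∧ P (lo r) (hi r) (g r)))

/-- a datum without light straddlers is a `PDECAtT` datum for every predicate. [this work] -/
theorem BDECAtT.pdecAtT {x T : ℝ} {j' M a : ℕ} {μ : ℕ → ℝ} (h : BDECAtT x T j' M a μ) (P : ℕ → ℕ → ℝ → Prop) :
    PDECAtT x T j' M a P μ := by
  obtain ⟨ρ, hρ, lam, g, lo, hi, h0, h1, hg, hlohi, hhi, hμ, hval⟩ := h
  exact ⟨ρ, hρ, lam, g, lo, hi, h0, h1, hg, hlohi, hhi, hμ, fun r hr => Or.inl (hval r hr)⟩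

/-- `PDECAtT` is monotone in the predicate. [this work] -/
theorem pdecAtT_mono {x T : ℝ} {j' M a : ℕ} {P Q : ℕ → ℕ → ℝ → Prop} {μ : ℕ → ℝ} (hPQ : ∀ lo hi g, P lo hi g → Q lo hi g)
    (h : PDECAtT x T j' M a P μ) : PDECAtT x T j' M a Q μ := by
  obtain ⟨ρ, hρ, lam, g, lo, hi, h0, h1, hg, hlohi, hhi, hμ, hval⟩ := h
  refine ⟨ρ, hρ, lam, g, lo, hi, h0, h1, hg, hlohi, hhi, hμ, fun r hr => ?_⟩
  rcases hval r hr with hB | ⟨h1', h2, h3, h4, h5, h6, h7, hP⟩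
  · exact Or.inl hB
  · exact Or.inr ⟨h1', h2, h3, h4, h5, h6, h7, hPQ _ _ _ hP⟩

/-- **A PLAIN DATUM ALL OF WHOSE POTENTIAL LIGHT STRADDLERS SATISFY `P`.**  If `μ ∈ D(T, j′)` on `{0..M}` (`x < 1`) and `P lo hi g` holds for every
light straddling credit pair that could occur in a datum (`lo < hi ≤ j′`, `j′ + 1 ≤ hi + a`, `hi ≤ M`, `2lo < T`, `x² < g < x`, `g ≤ 1`, credit
`≥ T`), then `μ` has a `PDECAtT` datum: every valid component of a `DECAtT` datum is heavy, or a pair with self-sufficient `lo`, or a light credit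
pair — below the straddle line (`BValidAt`) or a light straddler. [this work] -/
theorem pdecAtT_of_decAtT {x T : ℝ} {j' M a : ℕ} {P : ℕ → ℕ → ℝ → Prop} {μ : ℕ → ℝ} (hx1 : x < 1) (h : DECAtT x T j' M μ)
    (hP : ∀ (lo hi : ℕ) (g : ℝ), lo < hi → hi ≤ j' → j' + 1 ≤ hi + a → hi ≤ M → 2 * (lo : ℝ) < T → x ^ 2 < g → g < x → g ≤ 1 →
      T ≤ 2 * (lo : ℝ) + ((hi : ℝ) - lo) * ((g - x ^ 2) / (1 - x)) → P lo hi g) :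
    PDECAtT x T j' M a P μ := by
  obtain ⟨ρ, hρ, lam, g, lo, hi, h0, h1, hg, hlohi, hhi, hμ, hval⟩ := h
  refine ⟨ρ, hρ, lam, g, lo, hi, h0, h1, hg, hlohi, hhi, hμ, fun r hr => ?_⟩
  rcases hval r hr with ⟨heq, hS⟩ | ⟨hlt, hgi, hxg⟩ | ⟨hlt, hhij, hcr⟩
  · exact Or.inl (Or.inl (Or.inl ⟨heq, hS⟩))
  · exact Or.inl (Or.inl (Or.inr (Or.inl ⟨hlt, hgi, hxg⟩)))
  · by_cases hxg : x ≤ g r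
    · rw [if_pos hxg] at hcr
      exact Or.inl (Or.inl (Or.inr (Or.inr ⟨hlt, hhij, hxg, hcr⟩)))
    · rw [if_neg hxg] at hcr
      have hgx : g r < x := not_le.1 hxg
      by_cases hlo : T ≤ 2 * (lo r : ℝ)
      · exact Or.inl (Or.inr (Or.inl ⟨hlt, Or.inl hlo⟩))
      · have hlow : 2 * (lo r : ℝ) < T := not_le.1 hlo
        -- the light credit rate is positive, hence `x² < g`
        have hd : (0 : ℝ) < (hi r : ℝ) - lo r := by
          have : (lo r : ℝ) < hi r := by exact_mod_cast hlt
          linarith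
        have h1x : 0 < 1 - x := by linarith
        have hκ : 0 < (g r - x ^ 2) / (1 - x) := by
          by_contra hneg
          have hle : (g r - x ^ 2) / (1 - x) ≤ 0 := not_lt.1 hneg
          have := mul_nonpos_iff.2 (Or.inl ⟨hd.le, hle⟩)
          linarith
        have hx2 : x ^ 2 < g r := by
          have := (div_pos_iff_of_pos_right h1x).1 hκ
          linarith
        by_cases hstr : hi r + a ≤ j'
        · exact Or.inl (Or.inr (Or.inr ⟨hlt, hstr, hx2, hgx, hcr⟩))
        · exact Or.inr ⟨hlt, hhij, by omega, hlow, hx2, hgx, hcr,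
            hP (lo r) (hi r) (g r) hlt hhij (by omega) (hhi r) hlow hx2 hgx (hg r).2 hcr⟩

/-! ### The light straddling piece at a raised target -/

/-- **THE "TRIVIAL SIDE" DISCHARGE OF A LIGHT STRADDLER.**  For any gate `γ ∈ [0,1]` and positions `lo ≤ hi ≤ M₂`: if the `lo`-copy of `μ₁` is DEC at
the RAISED target `T₁ + T₂ − 2lo` at layer `j′ − lo` (when `lo ≤ j′`) and the `hi`-copy at `T₁` at layer `j′ − hi` with `hi` self-sufficient for
`(T₂, j′)`, then `(1−γ)·shift_lo μ₁ + γ·shift_hi μ₁ ∈ D(T₁ + T₂, j′)` — both shifted copies are (S)-terms (`shift_point_decAtT'`, the `lo`-copy with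
the split `(T₁ + T₂ − 2lo) + 2lo`).  This is the case of the residue in which the light straddler's low row reads the other factor in giant mode.
[this work] -/
theorem shift_lightPair_decAtT_of_higherTarget (x T₁ T₂ γ : ℝ) (j' M₁ M₂ lo hi : ℕ) (μ₁ : ℕ → ℝ) (hx0 : 0 < x) (hx1 : x < 1)
    (h10 : ∀ h, 0 ≤ μ₁ h) (h1M : ∀ h, M₁ < h → μ₁ h = 0) (h11 : ∑ h ∈ Finset.range (M₁ + 1), μ₁ h = 1)
    (hlohi : lo ≤ hi) (hhi : hi ≤ M₂) (hγ : 0 ≤ γ ∧ γ ≤ 1)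
    (hlo : lo ≤ j' → DECAtT x (T₁ + T₂ - 2 * (lo : ℝ)) (j' - lo) M₁ μ₁)
    (hhi' : hi ≤ j' → DECAtT x T₁ (j' - hi) M₁ μ₁) (hS : T₂ ≤ 2 * (hi : ℝ) ∨ j' + 1 ≤ hi) :
    DECAtT x (T₁ + T₂) j' (M₁ + M₂) (fun h => (1 - γ) * SH[μ₁, lo, h] + γ * SH[μ₁, hi, h]) := by
  have hlo' := shift_point_decAtT' x (T₁ + T₂ - 2 * (lo : ℝ)) (2 * (lo : ℝ)) j' M₁ M₂ lo μ₁ hx0 hx1 h10 h1M h11 (hlohi.trans hhi)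
    hlo (Or.inl le_rfl)
  rw [show T₁ + T₂ - 2 * (lo : ℝ) + 2 * (lo : ℝ) = T₁ + T₂ by ring] at hlo'
  have hhi2 := shift_point_decAtT' x T₁ T₂ j' M₁ M₂ hi μ₁ hx0 hx1 h10 h1M h11 hhi hhi' hS
  have := decAtT_mixture (1 - γ) (by linarith [hγ.2]) (by linarith [hγ.1]) hlo' hhi2
  have e : (fun h => (1 - γ) * SH[μ₁, lo, h] + (1 - (1 - γ)) * SH[μ₁, hi, h])
      = fun h => (1 - γ) * SH[μ₁, lo, h] + γ * SH[μ₁, hi, h] := by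
    funext h; ring
  rw [e] at this
  exact this

/-! ### The theorem -/

/-- **CONVOLUTION CLOSURE FROM ONE DATUM MODULO ITS LIGHT STRADDLERS.**  Floor `0 < x < 1`; `μ₁ ≥ 0` a probability law on `{0..M₁}`, DEC at target
`T₁` at every layer of the window `[j′ − M₂, j′]`; `μ₂` with a `PDECAtT` datum at `(T₂, j′)` relative to `M₁` whose every light straddling component
`{lo, hi; g}` has `(1−g)·shift_lo μ₁ + g·shift_hi μ₁ ∈ D(T₁+T₂, j′)` on `{0..M₁+M₂}`.  Then `lconv M₁ M₂ μ₁ μ₂ ∈ D(T₁+T₂, j′)`: the heavy, self-pair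
and non-straddling light pieces are those of census-1 g20's one-sided theorem (via the typer's `sliceClosedWindowT_holds`), the light straddlers are the
hypothesis, and `decAtT_finite_mixture` assembles. [this work] -/
theorem lconv_decAtT_of_window_pdecAtT (x T₁ T₂ : ℝ) (j' M₁ M₂ : ℕ) (μ₁ μ₂ : ℕ → ℝ) (hx0 : 0 < x) (hx1 : x < 1)
    (h10 : ∀ h, 0 ≤ μ₁ h) (h1M : ∀ h, M₁ < h → μ₁ h = 0) (h11 : ∑ h ∈ Finset.range (M₁ + 1), μ₁ h = 1)
    (hwin : ∀ j'', j'' ≤ j' → j' ≤ j'' + M₂ → DECAtT x T₁ j'' M₁ μ₁)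
    (hμ₂ : PDECAtT x T₂ j' M₂ M₁
      (fun lo hi g => DECAtT x (T₁ + T₂) j' (M₁ + M₂) (fun h => (1 - g) * SH[μ₁, lo, h] + g * SH[μ₁, hi, h])) μ₂) :
    DECAtT x (T₁ + T₂) j' (M₁ + M₂) (lconv M₁ M₂ μ₁ μ₂) := by
  classical
  obtain ⟨ρ, hρ, lam, gg, lo, hi, h0, h1, hgg, hlohi, hhi, hμ, hval⟩ := hμ₂
  have hmix : ∀ t, lconv M₁ M₂ μ₁ μ₂ t = ∑ r, lam r * lconv M₁ M₂ μ₁ (fun k => TP[lo r, hi r, gg r, k]) t := by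
    intro t
    rw [← lconv_sum_right]
    simp only [lconv]
    refine Finset.sum_congr rfl fun i _ => Finset.sum_congr rfl fun k _ => ?_
    rw [hμ k]
  refine decAtT_finite_mixture x _ j' (M₁ + M₂) _ lam (fun r => lconv M₁ M₂ μ₁ (fun k => TP[lo r, hi r, gg r, k]))
    h0 h1 hmix fun r hr => ?_
  have e : lconv M₁ M₂ μ₁ (fun k => TP[lo r, hi r, gg r, k]) = fun h => (1 - gg r) * SH[μ₁, lo r, h] + gg r * SH[μ₁, hi r, h] := by
    funext h; exact lconv_TP M₁ M₂ (lo r) (hi r) μ₁ (gg r) h1M ((hlohi r).trans (hhi r)) (hhi r) h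
  rw [e]
  rcases hval r hr with hB | ⟨_, _, _, _, _, _, _, hP⟩
  · rcases hB with hH | ⟨hlt, hS⟩ | ⟨hlt, hstr, hγ0, hγx, hcr⟩
    · -- heavy components: (S), (G), heavy (N)
      rcases hH with ⟨heq, hS⟩ | ⟨hlt, hj, hxγ⟩ | ⟨hlt, hhij, hxγ, hcr⟩
      · have e2 : (fun h => (1 - gg r) * SH[μ₁, lo r, h] + gg r * SH[μ₁, hi r, h]) = fun h => SH[μ₁, lo r, h] := by
          funext h; rw [heq]; ring
        rw [e2]
        exact shift_point_decAtT' x T₁ T₂ j' M₁ M₂ (lo r) μ₁ hx0 hx1 h10 h1M h11 ((hlohi r).trans (hhi r))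
          (fun hk => hwin (j' - lo r) (by omega) (by have := (hlohi r).trans (hhi r); omega)) hS
      · exact shift_giant_decAtT x _ j' M₁ M₂ (lo r) (hi r) μ₁ (gg r) hx0 hx1 h10 h1M h11 ((hlohi r).trans (hhi r)) (hhi r) hj hxγ
          (hgg r).2
      · exact shift_pair_decAtT_window sliceClosedWindowT_holds x T₁ _ (gg r) j' M₁ M₂ (lo r) (hi r) μ₁ hx0 hx1 h10 h1M h11 hlt hhij
          (hhi r) hxγ (hgg r).2 (fun j'' ha hb => hwin j'' (by omega) (by have := hhi r; omega)) (by linarith)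
    · -- pair with self-sufficient lo
      exact shift_selfPair_decAtT x T₁ T₂ (gg r) j' M₁ M₂ (lo r) (hi r) μ₁ hx0 hx1 h10 h1M h11 hlt.le (hhi r) (hgg r) hS hwin
    · -- light pair without straddler
      exact shift_lightPair_decAtT_noStraddle x T₁ _ (gg r) j' M₁ M₂ (lo r) (hi r) μ₁ hx0 hx1 hlt (hhi r) hγ0 hγx hstr
        (hwin (j' - lo r) (by omega) (by have := (hlohi r).trans (hhi r); omega)) (by linarith)
  · -- light straddler: the hypothesis
    exact hP

/-- the MIRROR form: `μ₁` carries the `PDECAtT` datum (relative to `M₂`), `μ₂` is window-DEC on `[j′ − M₁, j′]`. [this work] -/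
theorem lconv_decAtT_of_pdecAtT_window (x T₁ T₂ : ℝ) (j' M₁ M₂ : ℕ) (μ₁ μ₂ : ℕ → ℝ) (hx0 : 0 < x) (hx1 : x < 1)
    (h20 : ∀ h, 0 ≤ μ₂ h) (h2M : ∀ h, M₂ < h → μ₂ h = 0) (h21 : ∑ h ∈ Finset.range (M₂ + 1), μ₂ h = 1)
    (hμ₁ : PDECAtT x T₁ j' M₁ M₂
      (fun lo hi g => DECAtT x (T₂ + T₁) j' (M₂ + M₁) (fun h => (1 - g) * SH[μ₂, lo, h] + g * SH[μ₂, hi, h])) μ₁)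
    (hwin : ∀ j'', j'' ≤ j' → j' ≤ j'' + M₁ → DECAtT x T₂ j'' M₂ μ₂) :
    DECAtT x (T₁ + T₂) j' (M₁ + M₂) (lconv M₁ M₂ μ₁ μ₂) := by
  have h := lconv_decAtT_of_window_pdecAtT x T₂ T₁ j' M₂ M₁ μ₂ μ₁ hx0 hx1 h20 h2M h21 hwin hμ₁
  rw [add_comm T₂ T₁, add_comm M₂ M₁, ← lconv_comm] at h
  exact h

/-! ### The raised-target criterion (appended, census-1 g21) -/

/-- **THE RAISED-TARGET CRITERION (unconditional; the "trivial side" of the residue census).**  `0 < x < 1`; `μ₁ ≥ 0` a probability law on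
`{0..M₁}`, DEC(T₁, ·) on the window `[j′ − M₂, j′]`; `μ₂` with a PLAIN datum at `(T₂, j′)` on `{0..M₂}`.  If for every potential light straddling
credit pair `{lo, hi; g}` of such a datum (`lo < hi ≤ j′ < hi + M₁`, `hi ≤ M₂`, `2lo < T₂`, `x² < g < x`, credit `≥ T₂`) the sliced factor `μ₁` is DEC at the
RAISED target `T₁ + T₂ − 2lo` at the layer `j′ − lo`, then `lconv M₁ M₂ μ₁ μ₂ ∈ D(T₁ + T₂, j′)`: `pdecAtT_of_decAtT` +
`shift_lightPair_decAtT_of_higherTarget` (the `hi`-copy is an (S)-term since a light credit pair has `2hi > lo + hi ≥ T₂`) + `lconv_decAtT_of_window_pdecAtT`.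
Census (memo CONV-RESIDUE-G21 §3 (a), kit j154424): 37 809 of the 87 568 censused residue pairs (2-low atom ⊗ 2-low atom) have a side satisfying this
criterion — the light straddler's low row reads the partner atom in giant mode. [this work] -/
theorem lconv_decAtT_of_window_decAtT_raised (x T₁ T₂ : ℝ) (j' M₁ M₂ : ℕ) (μ₁ μ₂ : ℕ → ℝ) (hx0 : 0 < x) (hx1 : x < 1)
    (h10 : ∀ h, 0 ≤ μ₁ h) (h1M : ∀ h, M₁ < h → μ₁ h = 0) (h11 : ∑ h ∈ Finset.range (M₁ + 1), μ₁ h = 1)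
    (hwin : ∀ j'', j'' ≤ j' → j' ≤ j'' + M₂ → DECAtT x T₁ j'' M₁ μ₁) (hμ₂ : DECAtT x T₂ j' M₂ μ₂)
    (hraise : ∀ (lo hi : ℕ) (g : ℝ), lo < hi → hi ≤ j' → j' + 1 ≤ hi + M₁ → hi ≤ M₂ → 2 * (lo : ℝ) < T₂ → x ^ 2 < g → g < x → g ≤ 1 →
      T₂ ≤ 2 * (lo : ℝ) + ((hi : ℝ) - lo) * ((g - x ^ 2) / (1 - x)) → DECAtT x (T₁ + T₂ - 2 * (lo : ℝ)) (j' - lo) M₁ μ₁) :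
    DECAtT x (T₁ + T₂) j' (M₁ + M₂) (lconv M₁ M₂ μ₁ μ₂) := by
  refine lconv_decAtT_of_window_pdecAtT x T₁ T₂ j' M₁ M₂ μ₁ μ₂ hx0 hx1 h10 h1M h11 hwin
    (pdecAtT_of_decAtT hx1 hμ₂ fun lo hi g hlt hhij hstr hhiM hlow hx2 hgx hg1 hcr => ?_)
  -- the `hi` of a light credit pair is self-sufficient: `T₂ ≤ lo + hi < 2hi`
  have hd : (0 : ℝ) < (hi : ℝ) - lo := by
    have : (lo : ℝ) < hi := by exact_mod_cast hlt
    linarith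
  have h1x : 0 < 1 - x := by linarith
  have hκ : (g - x ^ 2) / (1 - x) ≤ 1 := by
    rw [div_le_one h1x]; nlinarith [sq_nonneg (1 - x), sq_nonneg x]
  have hS : T₂ ≤ 2 * (hi : ℝ) := by
    have h1 : ((hi : ℝ) - lo) * ((g - x ^ 2) / (1 - x)) ≤ (hi : ℝ) - lo := mul_le_of_le_one_right hd.le hκ
    have : (lo : ℝ) < hi := by exact_mod_cast hlt
    linarith
  exact shift_lightPair_decAtT_of_higherTarget x T₁ T₂ g j' M₁ M₂ lo hi μ₁ hx0 hx1 h10 h1M h11 hlt.le hhiM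
    ⟨by nlinarith [sq_nonneg x], hg1⟩ (fun _ => hraise lo hi g hlt hhij hstr hhiM hlow hx2 hgx hg1 hcr)
    (fun _ => hwin (j' - hi) (by omega) (by omega)) (Or.inl hS)

end LawDec

end Quant

end Summit.CriticalPhenomena.PercolationContinuityZ3.Theorems
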